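import Literature.AlgebraicGeometry.Morphisms.CechModuleH2Refinement
import Literature.AlgebraicGeometry.Morphisms.CechModuleH2TwoCovers
import HarnessLib

/-!
# The refinement map is a map of complexes in degree `2`

Sequel of `CechModuleH2Refinement.lean` (the refinement map `cechMRefineC2` on Čech `2`-cochains of
a sheaf of `𝒪_X`-modules `M` on an `A`-scheme `f : X → Spec A`, for a map of families
`τ : 𝒱 → 𝒰`, `V_j ⊆ U_{τ j}`; Görtz–Wedhorn II (21.16), Def. 21.71) and of `CechModuleH2.lean`
(`d¹`, `d²`, `Ž²`, `B̌²` of the full ordered Čech complex):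

* `cechMD1_refineC1` — `d¹ ∘ ρ = ρ ∘ d¹` (refinement is a map of complexes, Görtz–Wedhorn II
  (21.16)), hence `ρ` preserves `2`-coboundaries (`refineMC2_mem_cechMB2`) and — through the
  restricted cocycle identity `cechMZ2.cocycle_res` of `CechModuleH2TwoCovers.lean` — `2`-cocycles
  (`refineMC2_mem_cechMZ2`), so that it induces `Ȟ²(𝒰, M) → Ȟ²(𝒱, M)`;
* `cechMRefineC1_refineC1`, `cechMRefineC2_refineC2` — functoriality of `ρ` in the map of families
  (refining twice is refining once).

The contractibility of families containing their union and the cover-independence of the vanishing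
of `Ȟ²` are in `CechModuleH2CoverIndependence.lean`.  Everything is proved; no named facts; no
definitions. Mathlib searched (pin v4.32): no Čech refinement maps for sheaves of modules
(cf. `CechModuleRefinement.lean`).

## References

* U. Görtz, T. Wedhorn, *Algebraic Geometry II: Cohomology of Schemes*, Springer Spektrum (2023),
  doi:10.1007/978-3-658-43031-3: (21.16) Def. 21.71 and Lemma 21.72, p. 262. [GortzWedhorn2023]
* The Stacks Project, Tag 09UY (refinements and Čech cohomology), Tag 01ED. [StacksProject]
-/

noncomputable section

open CategoryTheory AlgebraicGeometry Limits TopologicalSpace Opposite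

universe u v w

namespace Literature.AlgebraicGeometry.Morphisms

variable {A : Type u} [CommRing A] {X : Scheme.{u}} (f : X ⟶ Spec (.of A)) (M : X.Modules)

/-! ## Refinement is a map of complexes in degree `2` -/

section Refine

variable {ι : Type v} {ι' : Type w} (U : ι → X.Opens) (V : ι' → X.Opens) (τ : ι' → ι)
  (hτ : ∀ j, V j ≤ U (τ j))

/-- **Refinement commutes with `d¹`.** [cite: GortzWedhorn2023, (21.16) (p. 262)] -/
theorem cechMD1_refineC1 (c : CechMC1 f M U) :
    cechMD1 f M V (cechMRefineC1 f M U V τ hτ c) =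
      cechMRefineC2 f M U V τ hτ (cechMD1 f M U c) := by
  funext j j' j''
  simp only [cechMD1_apply, cechMRefineC1_apply, cechMRefineC2_apply, map_sub, map_add,
    MSections.res_res]

/-- Refinement maps `2`-coboundaries to `2`-coboundaries (the refinement map is a map of
complexes). [cite: GortzWedhorn2023, (21.16) Def. 21.71 (p. 262)] -/
theorem refineMC2_mem_cechMB2 {e : CechMC2 f M U} (he : e ∈ cechMB2 f M U) :
    cechMRefineC2 f M U V τ hτ e ∈ cechMB2 f M V := by
  rw [mem_cechMB2_iff] at he ⊢
  obtain ⟨c, rfl⟩ := he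
  exact ⟨cechMRefineC1 f M U V τ hτ c, cechMD1_refineC1 f M U V τ hτ c⟩

/-- Refinement maps `2`-cocycles to `2`-cocycles (checked through the restricted cocycle identity;
the refinement map is a map of complexes). [cite: GortzWedhorn2023, (21.16) Def. 21.71 (p. 262)] -/
theorem refineMC2_mem_cechMZ2 {e : CechMC2 f M U} (he : e ∈ cechMZ2 f M U) :
    cechMRefineC2 f M U V τ hτ e ∈ cechMZ2 f M V := by
  rw [mem_cechMZ2_iff]
  funext j j' j'' j'''
  rw [cechMD2_apply, cechMRefineC2_apply, cechMRefineC2_apply, cechMRefineC2_apply,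
    cechMRefineC2_apply, MSections.res_res, MSections.res_res, MSections.res_res, MSections.res_res]
  exact cechMZ2.cocycle_res f M U he (τ j) (τ j') (τ j'') (τ j''')
    (((inf_le_left.trans inf_le_left).trans inf_le_left).trans (hτ j))
    (((inf_le_left.trans inf_le_left).trans inf_le_right).trans (hτ j'))
    ((inf_le_left.trans inf_le_right).trans (hτ j'')) (inf_le_right.trans (hτ j'''))

/-- Refining twice is refining once (on `1`-cochains): for `W_k ⊆ V_{σ k} ⊆ U_{τ σ k}`
(functoriality of (21.16) in the map of families). [cite: GortzWedhorn2023, (21.16) Def. 21.71 (p. 262)] -/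
theorem cechMRefineC1_refineC1 {ι'' : Type*} (W : ι'' → X.Opens) (σ : ι'' → ι')
    (hσ : ∀ k, W k ≤ V (σ k)) (c : CechMC1 f M U) :
    cechMRefineC1 f M V W σ hσ (cechMRefineC1 f M U V τ hτ c) =
      cechMRefineC1 f M U W (τ ∘ σ) (fun k => (hσ k).trans (hτ (σ k))) c := by
  funext k k'
  simp only [cechMRefineC1_apply, MSections.res_res]
  rfl

/-- Refining twice is refining once (on `2`-cochains; functoriality of (21.16) in the map of
families). [cite: GortzWedhorn2023, (21.16) Def. 21.71 (p. 262)] -/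
theorem cechMRefineC2_refineC2 {ι'' : Type*} (W : ι'' → X.Opens) (σ : ι'' → ι')
    (hσ : ∀ k, W k ≤ V (σ k)) (e : CechMC2 f M U) :
    cechMRefineC2 f M V W σ hσ (cechMRefineC2 f M U V τ hτ e) =
      cechMRefineC2 f M U W (τ ∘ σ) (fun k => (hσ k).trans (hτ (σ k))) e := by
  funext k k' k''
  simp only [cechMRefineC2_apply, MSections.res_res]
  rfl

end Refine

end Literature.AlgebraicGeometry.Morphisms

end
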